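import Summits.BirchSwinnertonDyer.BirchSwinnertonDyer.Theses.ErratumRoadFive

/-!
# Glue item 19596 `ShimuraCurveInputsOfParts` of route K2 `ErratumRoadFive` (rev 8, D1 Shimura cash-in; by-name
# split of the support `ShimuraCurveInputs`)

The three by-name published inputs (`nonempty_shimuraParametrizationData`, Pasten 2024's Ribet–Takahashi package,
the Shimura-curve Heegner-point Gross–Zagier–Kolyvagin fact), in the gate's order, reassemble the parent conjunction.
Pure logic — the same one-liner as K2@3's `classRecordThree_shimuraCurveInputsOfParts_holds` (item 19527); landed
by seat `bsd-stepL-imc-p1` (session g3) on director-bsd g4's INBOX line 2026-08-26T09:51:33Z («any idle stepL hand»).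
Nothing mathematical is asserted.
-/

/-- Glue item stmt-BirchSwinnertonDyer-19596 of route-BirchSwinnertonDyer-ErratumRoadFive (rev 8, split gen 1 of
`ShimuraCurveInputs`): the three by-name published inputs reassemble the conjunction. Pure logic. -/
theorem erratumRoadFive_shimuraCurveInputsOfParts_holds :
    Summit.BirchSwinnertonDyer.BirchSwinnertonDyer.Theses.ErratumRoadFive.ShimuraCurveInputsOfParts :=
  fun hJL hRT hHK => ⟨hJL, hRT, hHK⟩
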